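import Summits.HodgeConjecture.HodgeConjecture.Theses.ELineTransport

/-!
# Route `ELineTransport` — support item `LatticeEStructure` (stmt-HodgeConjecture-12554)

E-STRUCTURES EXIST ON THE RATIONAL K3 FORM: for every non-square `m` there is `J ∈ M₂₂(ℚ)` with
`J² = m`, self-adjoint for `D = diag(1,1,1,-1,…,-1)` (`Jᵀ D = D J`), whose `(-√m)`-eigenspace in `ℝ²²` is
negative definite for `D`.

Construction (explicit, by blocks; `p = (m+1)/2`, `q = (m-1)/2`, so `p² - q² = m`, and
`m = a² + b² + c² + d²` by Lagrange):
* on each pair of coordinates `(k, k + 3)`, `k < 3` (signs `(+, -)`): the block `[[p, q], [-q, -p]]`,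
  which squares to `p² - q² = m`, is `diag(1,-1)`-self-adjoint, and whose `(-√m)`-eigenline
  `q y = -(p + √m) x` has `x² - y² = x²(q² - (p+√m)²)/q² < 0`;
* on the coordinates `6…13` and `14…21` (signs all `-`): the symmetric block `[[0, Q], [Qᵀ, 0]]` with `Q`
  the left-multiplication matrix of the quaternion `a + bi + cj + dk` (`Q Qᵀ = Qᵀ Q = m`), which squares
  to `m`; there `D = -1` is negative definite outright.
The blocks are assembled on `(Fin 3 ⊕ Fin 3) ⊕ ((Fin 4 ⊕ Fin 4) ⊕ (Fin 4 ⊕ Fin 4))` and transported to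
`Fin 22` along the enumeration `0,1,2 | 3,4,5 | 6…13 | 14…21` (`finSumFinEquiv`), under which the block
form `diag(1,-1) ⊕ (-1)` becomes the statement's `D` (a `decide`d finite check).  No definition, no
named-fact hypothesis, no sorry.
-/

set_option linter.dupNamespace false

noncomputable section

open Matrix

namespace Summit.HodgeConjecture.HodgeConjecture.Theorems

namespace ELineLattice

variable {R : Type*} [CommRing R]

/-! ### Block identities (any commutative ring) -/


variable {R : Type*} [CommRing R]

/-- `Q Qᵀ = (a² + b² + c² + d²)·1` for the left-multiplication matrix `Q` of the quaternion
`a + bi + cj + dk`. -/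
theorem quat_mul_transpose (a b c d : R) :
    !![a, -b, -c, -d; b, a, -d, c; c, d, a, -b; d, -c, b, a] *
        (!![a, -b, -c, -d; b, a, -d, c; c, d, a, -b; d, -c, b, a])ᵀ =
      (a ^ 2 + b ^ 2 + c ^ 2 + d ^ 2) • (1 : Matrix (Fin 4) (Fin 4) R) := by
  ext i j
  fin_cases i <;> fin_cases j <;> simp [Matrix.mul_apply, Fin.sum_univ_four] <;> ring

/-- `Qᵀ Q = (a² + b² + c² + d²)·1` for the quaternion matrix `Q`. -/
theorem quat_transpose_mul (a b c d : R) :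
    (!![a, -b, -c, -d; b, a, -d, c; c, d, a, -b; d, -c, b, a])ᵀ *
        !![a, -b, -c, -d; b, a, -d, c; c, d, a, -b; d, -c, b, a] =
      (a ^ 2 + b ^ 2 + c ^ 2 + d ^ 2) • (1 : Matrix (Fin 4) (Fin 4) R) := by
  ext i j
  fin_cases i <;> fin_cases j <;> simp [Matrix.mul_apply, Fin.sum_univ_four] <;> ring

/-- `[[0, Q], [Qᵀ, 0]]² = s` when `Q Qᵀ = Qᵀ Q = s`. -/
theorem j8_mul_self {Q : Matrix (Fin 4) (Fin 4) R} {s : R} (h1 : Q * Qᵀ = s • 1) (h2 : Qᵀ * Q = s • 1) :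
    fromBlocks 0 Q Qᵀ 0 * fromBlocks 0 Q Qᵀ 0 = s • (1 : Matrix (Fin 4 ⊕ Fin 4) (Fin 4 ⊕ Fin 4) R) := by
  rw [fromBlocks_multiply]
  simp only [Matrix.zero_mul, Matrix.mul_zero, zero_add, add_zero, h1, h2]
  ext (i | i) (j | j) <;> simp [Matrix.one_apply, Matrix.smul_apply]

/-- `[[0, Q], [Qᵀ, 0]]` is symmetric. -/
theorem j8_transpose (Q : Matrix (Fin 4) (Fin 4) R) :
    (fromBlocks 0 Q Qᵀ 0 : Matrix (Fin 4 ⊕ Fin 4) (Fin 4 ⊕ Fin 4) R)ᵀ = fromBlocks 0 Q Qᵀ 0 := by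
  rw [fromBlocks_transpose]
  simp

/-- `[[p, q], [-q, -p]]² = p² - q²` (blocks of scalar `3 × 3` matrices). -/
theorem j6_mul_self (p q : R) :
    fromBlocks (diagonal fun _ : Fin 3 => p) (diagonal fun _ : Fin 3 => q)
        (diagonal fun _ : Fin 3 => -q) (diagonal fun _ : Fin 3 => -p) *
      fromBlocks (diagonal fun _ : Fin 3 => p) (diagonal fun _ : Fin 3 => q)
        (diagonal fun _ : Fin 3 => -q) (diagonal fun _ : Fin 3 => -p) =
      (p ^ 2 - q ^ 2) • (1 : Matrix (Fin 3 ⊕ Fin 3) (Fin 3 ⊕ Fin 3) R) := by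
  rw [fromBlocks_multiply]
  ext (i | i) (j | j) <;> simp [Matrix.one_apply, Matrix.smul_apply, diagonal_apply] <;>
    (try split_ifs) <;> (try intro _) <;> ring

/-- `[[p, q], [-q, -p]]ᵀ D₆ = D₆ [[p, q], [-q, -p]]` for `D₆ = [[1, 0], [0, -1]]`. -/
theorem j6_transpose_mul_d6 (p q : R) :
    (fromBlocks (diagonal fun _ : Fin 3 => p) (diagonal fun _ : Fin 3 => q)
        (diagonal fun _ : Fin 3 => -q) (diagonal fun _ : Fin 3 => -p))ᵀ *
      fromBlocks (1 : Matrix (Fin 3) (Fin 3) R) 0 0 (-1) =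
      fromBlocks (1 : Matrix (Fin 3) (Fin 3) R) 0 0 (-1) *
        fromBlocks (diagonal fun _ : Fin 3 => p) (diagonal fun _ : Fin 3 => q)
          (diagonal fun _ : Fin 3 => -q) (diagonal fun _ : Fin 3 => -p) := by
  rw [fromBlocks_transpose, fromBlocks_multiply, fromBlocks_multiply]
  simp only [diagonal_transpose, Matrix.mul_one, Matrix.one_mul, Matrix.mul_zero, Matrix.zero_mul,
    add_zero, zero_add, Matrix.mul_neg, Matrix.neg_mul, Matrix.mul_one, Matrix.one_mul]
  ext (i | i) (j | j) <;> simp [diagonal_apply]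

/-- The full block operator squares to `s` when both kinds of blocks do. -/
theorem jB_mul_self {J6 : Matrix (Fin 3 ⊕ Fin 3) (Fin 3 ⊕ Fin 3) R}
    {J8 : Matrix (Fin 4 ⊕ Fin 4) (Fin 4 ⊕ Fin 4) R} {s : R}
    (h6 : J6 * J6 = s • 1) (h8 : J8 * J8 = s • 1) :
    fromBlocks J6 0 0 (fromBlocks J8 0 0 J8) * fromBlocks J6 0 0 (fromBlocks J8 0 0 J8) =
      s • (1 : Matrix ((Fin 3 ⊕ Fin 3) ⊕ ((Fin 4 ⊕ Fin 4) ⊕ (Fin 4 ⊕ Fin 4)))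
        ((Fin 3 ⊕ Fin 3) ⊕ ((Fin 4 ⊕ Fin 4) ⊕ (Fin 4 ⊕ Fin 4))) R) := by
  rw [fromBlocks_multiply, fromBlocks_multiply]
  simp only [Matrix.zero_mul, Matrix.mul_zero, zero_add, add_zero, h6, h8]
  ext ((i | i) | ((i | i) | (i | i))) ((j | j) | ((j | j) | (j | j))) <;> simp [Matrix.one_apply]

/-- The full block operator is `D`-self-adjoint when the `6`-block is and the `8`-blocks are symmetric. -/
theorem jB_transpose_mul_dB {J6 D6 : Matrix (Fin 3 ⊕ Fin 3) (Fin 3 ⊕ Fin 3) R}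
    {J8 : Matrix (Fin 4 ⊕ Fin 4) (Fin 4 ⊕ Fin 4) R}
    (h6 : J6ᵀ * D6 = D6 * J6) (h8 : J8ᵀ = J8) :
    (fromBlocks J6 0 0 (fromBlocks J8 0 0 J8))ᵀ *
        fromBlocks D6 0 0 (-1 : Matrix ((Fin 4 ⊕ Fin 4) ⊕ (Fin 4 ⊕ Fin 4)) _ R) =
      fromBlocks D6 0 0 (-1 : Matrix ((Fin 4 ⊕ Fin 4) ⊕ (Fin 4 ⊕ Fin 4)) _ R) *
        fromBlocks J6 0 0 (fromBlocks J8 0 0 J8) := by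
  rw [fromBlocks_transpose, fromBlocks_transpose, fromBlocks_multiply, fromBlocks_multiply]
  simp only [Matrix.transpose_zero, Matrix.zero_mul, Matrix.mul_zero, zero_add, add_zero, h6, h8,
    Matrix.mul_neg, Matrix.neg_mul, Matrix.mul_one, Matrix.one_mul, neg_zero]


/-! ### Reindexing the blocks to `Fin 22` -/

/-- Transport of the block signs `(+,+,+ | -,-,- | - … -)` along an enumeration `e` of the blocks whose
`(+)`-block is `{0, 1, 2}`. -/
theorem bSign_symm_eq (R : Type*) [Ring R]
    (e : ((Fin 3 ⊕ Fin 3) ⊕ ((Fin 4 ⊕ Fin 4) ⊕ (Fin 4 ⊕ Fin 4))) ≃ Fin 22)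
    (he : ∀ i : Fin 22, (∃ k : Fin 3, e.symm i = Sum.inl (Sum.inl k)) ↔ i.val < 3) (i : Fin 22) :
    (Sum.elim (Sum.elim (fun _ => 1) (fun _ => -1)) (fun _ => -1) : ((Fin 3 ⊕ Fin 3) ⊕ ((Fin 4 ⊕ Fin 4) ⊕ (Fin 4 ⊕ Fin 4))) → R) (e.symm i) =
      if i.val < 3 then (1 : R) else -1 := by
  have key := he i
  rcases h : e.symm i with (k | k) | u
  · rw [if_pos (key.mp ⟨k, h⟩)]
    rfl
  · have : ¬ i.val < 3 := fun hi => by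
      obtain ⟨k', hk'⟩ := key.mpr hi
      rw [h] at hk'
      cases hk'
    rw [if_neg this]
    rfl
  · have : ¬ i.val < 3 := fun hi => by
      obtain ⟨k', hk'⟩ := key.mpr hi
      rw [h] at hk'
      cases hk'
    rw [if_neg this]
    rfl

/-- The block form `[[1, 0], [0, -1]] ⊕ (-1)` is the diagonal matrix of the block signs. -/
theorem dB_eq_diagonal (R : Type*) [CommRing R] :
    (fromBlocks (fromBlocks (1 : Matrix (Fin 3) (Fin 3) R) 0 0 (-1)) 0 0
      (-1 : Matrix ((Fin 4 ⊕ Fin 4) ⊕ (Fin 4 ⊕ Fin 4)) _ R)) =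
      diagonal (Sum.elim (Sum.elim (fun _ => 1) (fun _ => -1)) (fun _ => -1) : ((Fin 3 ⊕ Fin 3) ⊕ ((Fin 4 ⊕ Fin 4) ⊕ (Fin 4 ⊕ Fin 4))) → R) := by
  ext ((i | i) | ((i | i) | (i | i))) ((j | j) | ((j | j) | (j | j))) <;>
    simp [Matrix.one_apply, diagonal_apply] <;> (split_ifs <;> simp)

/-- Reindexed along such an `e`, the block form is `diag(1, 1, 1, -1, …, -1)`. -/
theorem reindex_dB (R : Type*) [CommRing R]
    (e : ((Fin 3 ⊕ Fin 3) ⊕ ((Fin 4 ⊕ Fin 4) ⊕ (Fin 4 ⊕ Fin 4))) ≃ Fin 22)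
    (he : ∀ i : Fin 22, (∃ k : Fin 3, e.symm i = Sum.inl (Sum.inl k)) ↔ i.val < 3) :
    Matrix.reindex e e (fromBlocks (fromBlocks (1 : Matrix (Fin 3) (Fin 3) R) 0 0 (-1)) 0 0
      (-1 : Matrix ((Fin 4 ⊕ Fin 4) ⊕ (Fin 4 ⊕ Fin 4)) _ R)) =
      diagonal (fun i : Fin 22 => if i.val < 3 then (1 : R) else -1) := by
  rw [dB_eq_diagonal, reindex_apply, submatrix_diagonal_equiv]
  congr 1
  funext i
  exact bSign_symm_eq R e he i

/-- The standard enumeration `0,1,2 | 3,4,5 | 6…13 | 14…21` of the blocks has `(+)`-block `{0, 1, 2}`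
(a finite check). -/
theorem stdEnum_symm_plus_iff :
    ∀ i : Fin 22, (∃ k : Fin 3,
      (((finSumFinEquiv (m := 3) (n := 3)).sumCongr
      (((finSumFinEquiv (m := 4) (n := 4)).sumCongr (finSumFinEquiv (m := 4) (n := 4))).trans
        (finSumFinEquiv (m := 8) (n := 8)))).trans
    (finSumFinEquiv (m := 6) (n := 16)) : ((Fin 3 ⊕ Fin 3) ⊕ ((Fin 4 ⊕ Fin 4) ⊕ (Fin 4 ⊕ Fin 4))) ≃ Fin 22).symm i =
        Sum.inl (Sum.inl k)) ↔ i.val < 3 := by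
  decide

/-! ### Negativity on the `-√m`-eigenspace, in block coordinates -/

/-- In block coordinates: if `J w = -r w` with `J = [[p, q], [-q, -p]] ⊕ J₁₆`, `p, r > 0`, `q ≠ 0`,
`p² - q² = r²`, then `w = 0` or `Σ (±) w_u² < 0` for the sign pattern `(+ | - | -)`. -/
theorem neg_of_eigen {p q r : ℝ} (hp : 0 < p) (hq : q ≠ 0) (hr : 0 < r) (hpq : p ^ 2 - q ^ 2 = r ^ 2)
    (J16 : Matrix ((Fin 4 ⊕ Fin 4) ⊕ (Fin 4 ⊕ Fin 4)) ((Fin 4 ⊕ Fin 4) ⊕ (Fin 4 ⊕ Fin 4)) ℝ)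
    (w : ((Fin 3 ⊕ Fin 3) ⊕ ((Fin 4 ⊕ Fin 4) ⊕ (Fin 4 ⊕ Fin 4))) → ℝ) (hw : w ≠ 0)
    (heig : (fromBlocks (fromBlocks (diagonal fun _ : Fin 3 => p) (diagonal fun _ : Fin 3 => q)
        (diagonal fun _ : Fin 3 => -q) (diagonal fun _ : Fin 3 => -p)) 0 0 J16) *ᵥ w = (-r) • w) :
    dotProduct w (diagonal (Sum.elim (Sum.elim (fun _ => 1) (fun _ => -1)) (fun _ => -1) : ((Fin 3 ⊕ Fin 3) ⊕ ((Fin 4 ⊕ Fin 4) ⊕ (Fin 4 ⊕ Fin 4))) → ℝ) *ᵥ w) < 0 := by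
  -- block components of `w`
  set x : Fin 3 → ℝ := fun i => w (Sum.inl (Sum.inl i)) with hx
  set y : Fin 3 → ℝ := fun i => w (Sum.inl (Sum.inr i)) with hy
  set z : (Fin 4 ⊕ Fin 4) ⊕ (Fin 4 ⊕ Fin 4) → ℝ := fun u => w (Sum.inr u) with hz
  -- the first block row of the eigen-equation: `p x + q y = -r x`
  have hrow : ∀ i : Fin 3, p * x i + q * y i = -r * x i := by
    intro i
    have h := congrFun heig (Sum.inl (Sum.inl i))
    simp only [mulVec, dotProduct, Fintype.sum_sum_type, fromBlocks_apply₁₁, fromBlocks_apply₁₂,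
      diagonal_apply, Pi.smul_apply, smul_eq_mul, Matrix.zero_apply, zero_mul,
      Finset.sum_const_zero, add_zero, ite_mul, Finset.sum_ite_eq, Finset.mem_univ, if_true] at h
    linarith [h]
  have hyx : ∀ i, y i = -((p + r) / q) * x i := fun i => by
    field_simp
    linarith [hrow i]
  -- the quadratic form in block coordinates
  have hquad : dotProduct w (diagonal (Sum.elim (Sum.elim (fun _ => 1) (fun _ => -1)) (fun _ => -1) : ((Fin 3 ⊕ Fin 3) ⊕ ((Fin 4 ⊕ Fin 4) ⊕ (Fin 4 ⊕ Fin 4))) → ℝ) *ᵥ w) =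
      ∑ i, x i ^ 2 - ∑ i, y i ^ 2 - ∑ u, z u ^ 2 := by
    simp only [mulVec_diagonal, dotProduct, Fintype.sum_sum_type, Sum.elim_inl, Sum.elim_inr, hx, hy, hz]
    ring_nf
    simp only [Finset.sum_neg_distrib]
    ring
  have hκ : 1 < ((p + r) / q) ^ 2 := by
    rw [div_pow, one_lt_div (by positivity)]
    nlinarith
  rw [hquad]
  have hy2 : ∑ i, y i ^ 2 = ((p + r) / q) ^ 2 * ∑ i, x i ^ 2 := by
    rw [Finset.mul_sum]
    exact Finset.sum_congr rfl fun i _ => by rw [hyx i]; ring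
  rw [hy2]
  -- `w ≠ 0` gives `x ≠ 0 ∨ z ≠ 0` (as `y` is a multiple of `x`)
  have hxz : 0 < ∑ i, x i ^ 2 + ∑ u, z u ^ 2 := by
    by_contra hle
    push Not at hle
    have hx0 : ∀ i, x i = 0 := fun i => by
      nlinarith [Finset.single_le_sum (fun j _ => sq_nonneg (x j)) (Finset.mem_univ i),
        Finset.sum_nonneg fun u (_ : u ∈ Finset.univ) => sq_nonneg (z u), sq_nonneg (x i)]
    have hz0 : ∀ u, z u = 0 := fun u => by
      nlinarith [Finset.single_le_sum (fun v _ => sq_nonneg (z v)) (Finset.mem_univ u),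
        Finset.sum_nonneg fun j (_ : j ∈ Finset.univ) => sq_nonneg (x j), sq_nonneg (z u)]
    apply hw
    funext u
    rcases u with (i | i) | u
    · exact hx0 i
    · show y i = 0
      rw [hyx i, hx0 i, mul_zero]
    · exact hz0 u
  have hx2 : 0 ≤ ∑ i, x i ^ 2 := Finset.sum_nonneg fun i _ => sq_nonneg (x i)
  have hz2 : 0 ≤ ∑ u, z u ^ 2 := Finset.sum_nonneg fun u _ => sq_nonneg (z u)
  rcases hz2.eq_or_lt with hz0 | hzpos
  · have hxpos : 0 < ∑ i, x i ^ 2 := by linarith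
    have : ∑ i, x i ^ 2 < ((p + r) / q) ^ 2 * ∑ i, x i ^ 2 := by nlinarith
    linarith
  · have : ∑ i, x i ^ 2 ≤ ((p + r) / q) ^ 2 * ∑ i, x i ^ 2 := by nlinarith
    linarith


/-! ### Transport along the enumeration and assembly -/

/-- Pulling an eigen-equation back along a reindexing. -/
theorem mulVec_reindex_eq_smul_iff {ι κ : Type*} [Fintype ι] [Fintype κ] [DecidableEq ι] [DecidableEq κ]
    (e : ι ≃ κ) (M : Matrix ι ι ℝ) (v : κ → ℝ) (c : ℝ)
    (h : Matrix.reindex e e M *ᵥ v = c • v) : M *ᵥ (v ∘ e) = c • (v ∘ e) := by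
  rw [reindex_apply, submatrix_mulVec_equiv] at h
  funext u
  have := congrFun h (e u)
  simp only [Function.comp_apply, Equiv.symm_symm, Equiv.symm_apply_apply, Pi.smul_apply] at this
  simpa [Equiv.symm_symm] using this

/-- The quadratic form of a reindexed diagonal matrix, in the original coordinates. -/
theorem dotProduct_reindex_diagonal_mulVec {ι κ : Type*} [Fintype ι] [Fintype κ] [DecidableEq ι]
    [DecidableEq κ] (e : ι ≃ κ) (d : ι → ℝ) (v : κ → ℝ) :
    dotProduct v (Matrix.reindex e e (diagonal d) *ᵥ v) = dotProduct (v ∘ e) (diagonal d *ᵥ (v ∘ e)) := by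
  rw [reindex_apply, submatrix_diagonal_equiv]
  simp only [dotProduct, mulVec_diagonal, Function.comp_apply]
  rw [← e.sum_comp]
  simp

end ELineLattice

open ELineLattice in
/-- **Item stmt-HodgeConjecture-12554 (`LatticeEStructure`, route `ELineTransport`)**: for every non-square
`m` there is `J ∈ M₂₂(ℚ)` with `J² = m·1`, `Jᵀ D = D J` for `D = diag(1,1,1,-1,…,-1)`, and `vᵀ D v < 0` for
every non-zero real `v` with `J v = -√m v`.  Witness: three blocks `[[p, q], [-q, -p]]` (`p = (m+1)/2`,
`q = (m-1)/2`) on the coordinate pairs `(k, k+3)` and two quaternionic blocks `[[0, Q], [Qᵀ, 0]]`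
(`m = a²+b²+c²+d²`, Lagrange) on the remaining sixteen negative coordinates.  The type is literally the
route decl `Summit.HodgeConjecture.HodgeConjecture.Theses.ELineTransport.LatticeEStructure`.
[cite: BayerFluckigerVanGeemenSchuett2025, Cor. 11.4] -/
theorem eLineTransport_latticeEStructure_proof :
    Summit.HodgeConjecture.HodgeConjecture.Theses.ELineTransport.LatticeEStructure := by
  unfold Summit.HodgeConjecture.HodgeConjecture.Theses.ELineTransport.LatticeEStructure
  intro m hm
  -- numerology: `m ≥ 2`, `p = (m+1)/2 > 0`, `q = (m-1)/2 ≠ 0`, `p² - q² = m = a²+b²+c²+d²`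
  have hm0 : m ≠ 0 := by rintro rfl; exact hm ⟨0, rfl⟩
  have hm1 : m ≠ 1 := by rintro rfl; exact hm ⟨1, rfl⟩
  obtain ⟨a, b, c, d, habcd⟩ := Nat.sum_four_squares m
  have habcdQ : ((a : ℚ) ^ 2 + (b : ℚ) ^ 2 + (c : ℚ) ^ 2 + (d : ℚ) ^ 2) = (m : ℚ) := by exact_mod_cast habcd
  have hpqQ : (((m : ℚ) + 1) / 2) ^ 2 - (((m : ℚ) - 1) / 2) ^ 2 = (m : ℚ) := by ring
  -- the enumeration of the blocks
  have he := stdEnum_symm_plus_iff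
  refine ⟨Matrix.reindex (((finSumFinEquiv (m := 3) (n := 3)).sumCongr
            (((finSumFinEquiv (m := 4) (n := 4)).sumCongr (finSumFinEquiv (m := 4) (n := 4))).trans
              (finSumFinEquiv (m := 8) (n := 8)))).trans
          (finSumFinEquiv (m := 6) (n := 16)) : ((Fin 3 ⊕ Fin 3) ⊕ ((Fin 4 ⊕ Fin 4) ⊕ (Fin 4 ⊕ Fin 4))) ≃ Fin 22)
      (((finSumFinEquiv (m := 3) (n := 3)).sumCongr
            (((finSumFinEquiv (m := 4) (n := 4)).sumCongr (finSumFinEquiv (m := 4) (n := 4))).trans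
              (finSumFinEquiv (m := 8) (n := 8)))).trans
          (finSumFinEquiv (m := 6) (n := 16)) : ((Fin 3 ⊕ Fin 3) ⊕ ((Fin 4 ⊕ Fin 4) ⊕ (Fin 4 ⊕ Fin 4))) ≃ Fin 22)
      (fromBlocks
        (fromBlocks (diagonal fun _ : Fin 3 => ((m : ℚ) + 1) / 2) (diagonal fun _ : Fin 3 => ((m : ℚ) - 1) / 2)
          (diagonal fun _ : Fin 3 => -(((m : ℚ) - 1) / 2)) (diagonal fun _ : Fin 3 => -(((m : ℚ) + 1) / 2)))
        0 0
        (fromBlocks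
          (fromBlocks 0 !![(a : ℚ), -b, -c, -d; b, a, -d, c; c, d, a, -b; d, -c, b, a]
            (!![(a : ℚ), -b, -c, -d; b, a, -d, c; c, d, a, -b; d, -c, b, a])ᵀ 0)
          0 0
          (fromBlocks 0 !![(a : ℚ), -b, -c, -d; b, a, -d, c; c, d, a, -b; d, -c, b, a]
            (!![(a : ℚ), -b, -c, -d; b, a, -d, c; c, d, a, -b; d, -c, b, a])ᵀ 0))),
    ?_, ?_, ?_⟩
  · -- `J² = m`
    have h6 := j6_mul_self (R := ℚ) (((m : ℚ) + 1) / 2) (((m : ℚ) - 1) / 2)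
    rw [hpqQ] at h6
    have h8 := j8_mul_self (R := ℚ)
      (Q := !![(a : ℚ), -b, -c, -d; b, a, -d, c; c, d, a, -b; d, -c, b, a]) (s := (m : ℚ))
      (by rw [quat_mul_transpose, habcdQ]) (by rw [quat_transpose_mul, habcdQ])
    rw [reindex_apply, submatrix_mul_equiv, jB_mul_self h6 h8]
    ext i j
    simp only [submatrix_apply, Matrix.smul_apply, Matrix.one_apply, EmbeddingLike.apply_eq_iff_eq]
  · -- `Jᵀ D = D J`
    rw [← reindex_dB ℚ _ he, transpose_reindex]
    simp only [reindex_apply]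
    rw [submatrix_mul_equiv, submatrix_mul_equiv,
      jB_transpose_mul_dB (j6_transpose_mul_d6 (R := ℚ) _ _) (j8_transpose (R := ℚ) _)]
  · -- negativity on the `(-√m)`-eigenspace
    intro v hv heig
    -- the eigen-equation, with real entries, in block coordinates
    rw [reindex_apply, ← submatrix_map] at heig
    simp only [fromBlocks_map, transpose_map, diagonal_map (f := fun x : ℚ => (x : ℝ)) Rat.cast_zero,
      Matrix.map_zero (fun x : ℚ => (x : ℝ)) Rat.cast_zero, Rat.cast_neg, Rat.cast_div, Rat.cast_add,
      Rat.cast_sub, Rat.cast_natCast, Rat.cast_one, Rat.cast_ofNat] at heig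
    rw [← reindex_apply] at heig
    have heig' := mulVec_reindex_eq_smul_iff _ _ v _ heig
    have hw : (v ∘ (((finSumFinEquiv (m := 3) (n := 3)).sumCongr
      (((finSumFinEquiv (m := 4) (n := 4)).sumCongr (finSumFinEquiv (m := 4) (n := 4))).trans
        (finSumFinEquiv (m := 8) (n := 8)))).trans
    (finSumFinEquiv (m := 6) (n := 16)) : ((Fin 3 ⊕ Fin 3) ⊕ ((Fin 4 ⊕ Fin 4) ⊕ (Fin 4 ⊕ Fin 4))) ≃ Fin 22)) ≠ 0 := by
      intro h0
      apply hv
      funext i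
      have := congrFun h0 ((((finSumFinEquiv (m := 3) (n := 3)).sumCongr
      (((finSumFinEquiv (m := 4) (n := 4)).sumCongr (finSumFinEquiv (m := 4) (n := 4))).trans
        (finSumFinEquiv (m := 8) (n := 8)))).trans
    (finSumFinEquiv (m := 6) (n := 16)) : ((Fin 3 ⊕ Fin 3) ⊕ ((Fin 4 ⊕ Fin 4) ⊕ (Fin 4 ⊕ Fin 4))) ≃ Fin 22).symm i)
      simp only [Function.comp_apply, Equiv.apply_symm_apply, Pi.zero_apply] at this
      exact this
    have hm2 : (2 : ℝ) ≤ (m : ℝ) := by exact_mod_cast (show 2 ≤ m by omega)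
    have hp : (0 : ℝ) < ((m : ℝ) + 1) / 2 := by positivity
    have hq : ((m : ℝ) - 1) / 2 ≠ 0 := by
      intro h; have : (m : ℝ) = 1 := by linarith
      linarith
    have hr : (0 : ℝ) < Real.sqrt m := Real.sqrt_pos.mpr (by linarith)
    have hpq : (((m : ℝ) + 1) / 2) ^ 2 - (((m : ℝ) - 1) / 2) ^ 2 = Real.sqrt m ^ 2 := by
      rw [Real.sq_sqrt (by linarith)]
      ring
    have key := neg_of_eigen hp hq hr hpq _ _ hw heig'
    rw [← reindex_dB ℝ _ he, dB_eq_diagonal, dotProduct_reindex_diagonal_mulVec]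
    exact key

end Summit.HodgeConjecture.HodgeConjecture.Theorems

end
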